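import Summits.Ventures.HSemireg.WedgeSurfacePowersPerQRank
import Summits.Ventures.HSemireg.FormulaNSqueeze
import Summits.Ventures.HSemireg.FormulaNSurfacePowerPerQClosed
import Summits.Ventures.HSemireg.WedgeBoxPerQOverlap

/-!
# Venture HSemireg — the PER-`q` ranks of the `n`-fold SURFACE BOX, companion: TOTAL RANK = NUMBER OF CLASSES, and THE BLOCKS
# OVERLAP BY EXACTLY `n·[t^k](1 + 4t + t²)^{n−1}` — `Σ_{q ≤ 2n} rank_q = rank(F_n) + n·rank(F_{n−1})` in every degree `k`

HONEST FRAMING. Part of the Lean index of the computation cell `pub-hsemireg` (seat p10 gen 3, Sunday typer «UNIFORM-IN-n»).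
Finite-dimensional EXTERIOR ALGEBRA over a field and arithmetic ONLY: no variety, no cohomology theory, no sheaf, no Ext group, no
semiregularity map is constructed here; nothing here says that HC / HC_CM / HC_AV holds; no Literature fact is declared or used.
Custodian versions: STRUCTURE.md v1.0-SIGNED 9b196a05977dd067 (§1.1 C10 / C13; red-5's reader caution «Σ_q block ranks ≠ rank σ — the
blocks overlap»), theory/FORMULA-N.md PART A §4.1″ (th-6) / PART B §E (th-7).  Model and dictionary (quoted, NOT asserted): file 1/3
(`WedgeSurfacePowersPerQ.lean`); the rank theorem: file 3/3 (`WedgeSurfacePowersPerQRank.lean`).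

THIS FILE (companions of the per-q rank theorem, as `WedgeBoxPerQOverlap.lean` is for two factors): §1 **the range of `θ ↦ θ ∧ F_n` on
`⋀^k` is the span of ALL class vectors of degree `k`, and its rank is their number `|Kset n k|`** (disjoint supports again) — so, comparing
with p10 gen 2's Künneth iteration `finrank_range_surfaceBox`, **the number of classes of degree `k` is `[t^k](1 + 4t + t²)ⁿ`**
(`card_Kset`); §2 the class of `f` reaches exactly `z(f) + 1` blocks, all of index `≤ 2n`, hence **`Σ_{q ≤ 2n} |Fset n k q| = |Kset n k|
+ Σ_{f ∈ Kset n k} z(f)`**; §3 counting the pairs (class, empty block) by the empty block: `Σ_{f ∈ Kset (m+1) k} z(f) = (m+1)·|Kset m k|`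
(remove / insert the empty block, `Fin.insertNth`); §4 **THE OVERLAP IDENTITY** (`n = m + 1 ≥ 2`, every `k`, `a, c ≠ 0`):
`Σ_{q ≤ 2n} rank(q-block of θ ↦ θ ∧ F_n ∣ ⋀^k) = [t^k](1+4t+t²)ⁿ + n·[t^k](1+4t+t²)^{n−1} = rank(F_n ∣ ⋀^k) + n·rank(F_{n−1} ∣ ⋀^k)`
(`sum_finrank_range_blockProj_wedge_surfaceBox`, `…_eq_add`) — each empty factor's source `1` is ONE vector `a E_X + c E_Y` with components
in two blocks (th-6's coincidence), and the classes with a marked empty factor are the classes of the `(n−1)`-fold box; instances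
`105 = 51 + 3·18` (`FormulaNSurfacePowerPerQ.spCount_sum_three_two`'s `105` and `51`) and `304 = 100 + 4·51`; §5 th-7 §G's
`η`-WEIGHTS: `w = 2n − k − 2q` on the degree-`(k+2n)` monomials (`kweight_eq`) — the weight blocks ARE the `q`-blocks, as for two factors;
§5b the per-q RANK rows in
degrees 1, 2, 3 in CLOSED FORM for every `n` (`…_one_closed`, `…_two_closed`, `…_three_closed`; arithmetic in
`FormulaNSurfacePowerPerQClosed.lean`); §6 **(S2) ⇒ PER-q** (`finrank_range_blockProj_sigma_of_saturation`): with the bridge `σ ∘ ev = (θ ↦ θ ∧ F_n)` and the extremal count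
`dim Ext^k = [t^k](1+4t+t²)ⁿ` as HYPOTHESES BY VALUE (FORMULA-N THEOREM S, `FormulaNSqueeze.lean`), `ev` is onto, `σ` injective and the
`q`-blocks of `σ` ITSELF have ranks `spCount n k q` — the form of th-6 §4.1's measured rows; `Ext2` is NOT identified with a sheaf's Ext.
Namespace `Summit.Ventures.HSemireg.Wedge.SurfacePowers`, new names only; nothing of th-7 / th-6 / p3 / p10 g0–g2 restated.
-/

open Module Set Set.powersetCard Polynomial

namespace Summit.Ventures.HSemireg.Wedge.SurfacePowers

open Summit.Ventures.HSemireg.Wedge Summit.Ventures.HSemireg.Wedge.Kunneth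

variable (K : Type*) [Field K] {n : ℕ}

/-! ## §1. The total rank is the number of classes -/

/-- a class vector is non-zero (it reaches the block `q_f`). -/
lemma vec_ne_zero {a c : K} (ha : a ≠ 0) (hc : c ≠ 0) (f : Fin n → Fin 6) : vec K a c f ≠ 0 := by
  intro h
  have h1 := (blockProj_vec_ne_zero_iff K ha hc f (qff f)).mpr ⟨0, Nat.zero_le _, by ring⟩
  rw [h, map_zero] at h1
  exact h1 rfl

variable (n)

/-- the option data of degree `k` (all classes of degree-`k` sources). -/
def Kset (k : ℕ) : Finset (Fin n → Fin 6) := Finset.univ.filter fun f => kf f = k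

variable {n}

/-- membership in `Kset`. -/
lemma mem_Kset {k : ℕ} {f : Fin n → Fin 6} : f ∈ Kset n k ↔ kf f = k := by
  simp [Kset]

/-- **the range of `θ ↦ θ ∧ F_n` on `⋀^k K^{4n}` is the span of the class vectors of degree `k`** (`a, c ≠ 0`). -/
theorem range_wedge_surfaceBox_eq_span {a c : K} (ha : a ≠ 0) (hc : c ≠ 0) (k : ℕ) :
    LinearMap.range (wedge K (Fin (4 * n)) k (surfaceBox K (n := n) a c)) =
      Submodule.span K (Set.range fun f : Kset n k => vec K a c f.1) := by
  apply le_antisymm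
  · rw [range_wedge, Submodule.span_le]
    rintro _ ⟨s, hs, rfl⟩
    rw [SetLike.mem_coe]
    show B K (Fin (4 * n)) s * surfaceBox K (n := n) a c ∈ _
    obtain ⟨μ, -, e⟩ := B_mul_surfaceBox K ha hc s
    rw [e]
    apply Submodule.smul_mem
    rcases lprod_eq_smul_vec K hc s with h0 | ⟨f, hf, Λ, hΛ⟩
    · rw [h0]; exact Submodule.zero_mem _
    · rw [hΛ]
      exact Submodule.smul_mem _ _ (Submodule.subset_span ⟨⟨f, mem_Kset.mpr (hf.trans hs)⟩, rfl⟩)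
  · rw [Submodule.span_le]
    rintro _ ⟨⟨f, hf⟩, rfl⟩
    obtain ⟨μ, hμ, e⟩ := B_mul_surfaceBox K ha hc (src f)
    have hv : vec K a c f = μ⁻¹ • (B K (Fin (4 * n)) (src f) * surfaceBox K (n := n) a c) := by
      rw [e, smul_smul, inv_mul_cancel₀ hμ, one_smul]; rfl
    rw [SetLike.mem_coe]
    show vec K a c f ∈ _
    rw [hv]
    apply Submodule.smul_mem
    exact ⟨⟨B K (Fin (4 * n)) (src f), B_mem_exteriorPower K (by rw [← kf_eq_card_src, mem_Kset.mp hf])⟩, rfl⟩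

/-- **TOTAL RANK = NUMBER OF CLASSES**: `rank(θ ↦ θ ∧ F_n ∣ ⋀^k K^{4n}) = |Kset n k|`. -/
theorem finrank_range_wedge_surfaceBox_eq_card {a c : K} (ha : a ≠ 0) (hc : c ≠ 0) (k : ℕ) :
    finrank K (LinearMap.range (wedge K (Fin (4 * n)) k (surfaceBox K (n := n) a c))) = (Kset n k).card := by
  rw [range_wedge_surfaceBox_eq_span K ha hc, finrank_span_eq_card, Fintype.card_coe]
  apply linearIndependent_of_disjoint_support
  · rintro ⟨f, -⟩
    exact vec_ne_zero K ha hc f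
  · rintro ⟨f, hf⟩ ⟨f', hf'⟩ hne T
    exact coord_vec_eq_zero_or K ha hc (fun h => hne (Subtype.ext h)) T

/-- so **the number of classes of degree `k` is `[t^k](1 + 4t + t²)ⁿ`** (`n ≥ 1`) — two kernel rank computations of the same map
(p10 gen 2's Künneth iteration `finrank_range_surfaceBox` and the class count) compared; stated over `ℚ`. -/
theorem card_Kset (hn : 1 ≤ n) (k : ℕ) : (Kset n k).card = (surfPoly ^ n).coeff k := by
  rw [← finrank_range_wedge_surfaceBox_eq_card ℚ one_ne_zero one_ne_zero, finrank_range_surfaceBox ℚ hn one_ne_zero one_ne_zero]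

/-! ## §2. The blocks a class reaches, counted: `z(f) + 1` of them, all of index `≤ 2n` -/

/-- fixed part plus twice the empty blocks never exceeds `2n` (so every reached block has index `≤ 2n`). -/
lemma qff_add_two_zf_le (f : Fin n → Fin 6) : qff f + 2 * zf f ≤ 2 * n := by
  have h1 : ∀ o : Fin 6, lqf o + lz o ≤ 1 := by decide
  have h2 : qff f + zf f ≤ n := by
    rw [qff, zf, ← Finset.sum_add_distrib]
    exact (Finset.sum_le_sum fun i _ => h1 (f i)).trans (by simp)
  have h3 : zf f ≤ n := zf_le f
  omega

/-- the blocks reached by the class of `f`, among `0, …, 2n`, are the `z(f) + 1` values `q_f + 2j`, `j ≤ z(f)`. -/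
lemma filter_reach_eq_image (f : Fin n → Fin 6) :
    (Finset.range (2 * n + 1)).filter (fun q => ∃ j, j ≤ zf f ∧ q = qff f + 2 * j) =
      (Finset.range (zf f + 1)).image fun j => qff f + 2 * j := by
  ext q
  simp only [Finset.mem_filter, Finset.mem_range, Finset.mem_image]
  have := qff_add_two_zf_le f
  constructor
  · rintro ⟨-, j, hj, rfl⟩
    exact ⟨j, by omega, rfl⟩
  · rintro ⟨j, hj, rfl⟩
    exact ⟨by omega, j, by omega, rfl⟩

/-- their number is `z(f) + 1`. -/
lemma card_filter_reach (f : Fin n → Fin 6) :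
    ((Finset.range (2 * n + 1)).filter fun q => ∃ j, j ≤ zf f ∧ q = qff f + 2 * j).card = zf f + 1 := by
  rw [filter_reach_eq_image, Finset.card_image_of_injective _ (fun j j' (h : qff f + 2 * j = qff f + 2 * j') => by omega),
    Finset.card_range]

/-- **SUM OF THE BLOCK COUNTS = NUMBER OF CLASSES + NUMBER OF (CLASS, EMPTY BLOCK) PAIRS**:
`Σ_{q ≤ 2n} |Fset n k q| = |Kset n k| + Σ_{f ∈ Kset n k} z(f)`. -/
theorem sum_card_Fset (k : ℕ) :
    ∑ q ∈ Finset.range (2 * n + 1), (Fset n k q).card = (Kset n k).card + ∑ f ∈ Kset n k, zf f := by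
  have h1 : ∀ q, (Fset n k q).card = ∑ f ∈ Kset n k, (if ∃ j, j ≤ zf f ∧ q = qff f + 2 * j then 1 else 0) := by
    intro q
    rw [Finset.sum_boole, Nat.cast_id, Kset, Finset.filter_filter]
    congr 1
    ext f
    rw [mem_Fset, Finset.mem_filter, and_iff_right (Finset.mem_univ f)]
  simp_rw [h1]
  rw [Finset.sum_comm, Finset.card_eq_sum_ones, ← Finset.sum_add_distrib]
  refine Finset.sum_congr rfl fun f _ => ?_
  rw [Finset.sum_boole, Nat.cast_id, card_filter_reach, add_comm]

/-! ## §3. `Σ_{f ∈ Kset n k} z(f) = n · |Kset (n−1) k|`: remove the empty block -/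

/-- inserting an empty block at position `i` does not change the degree. -/
lemma kf_insertNth {m : ℕ} (i : Fin (m + 1)) (g : Fin m → Fin 6) : kf (Fin.insertNth i 0 g) = kf g := by
  rw [kf, Fin.sum_univ_succAbove _ i, Fin.insertNth_apply_same]
  simp only [Fin.insertNth_apply_succAbove]
  rw [show (opt 0).card = 0 by decide, zero_add]
  rfl

/-- the classes of degree `k` with block `i` empty correspond to the classes of degree `k` on the other `m` blocks. -/
lemma card_filter_empty_at {m : ℕ} (i : Fin (m + 1)) (k : ℕ) :
    ((Kset (m + 1) k).filter fun f => f i = 0).card = (Kset m k).card := by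
  have hinj : Function.Injective (Fin.insertNth (α := fun _ : Fin (m + 1) => Fin 6) i (0 : Fin 6)) :=
    fun g g' h => (Fin.insertNth_inj.mp h).2
  rw [← Finset.card_image_of_injective (Kset m k) hinj]
  congr 1
  ext f
  simp only [Finset.mem_filter, Finset.mem_image, mem_Kset]
  constructor
  · rintro ⟨hk, h0⟩
    refine ⟨Fin.removeNth i f, ?_, ?_⟩
    · rw [← kf_insertNth i, ← h0, Fin.insertNth_self_removeNth, hk]
    · rw [← h0, Fin.insertNth_self_removeNth]
  · rintro ⟨g, hg, rfl⟩
    exact ⟨by rw [kf_insertNth, hg], Fin.insertNth_apply_same _ _ _⟩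

/-- **`Σ_{f ∈ Kset (m+1) k} z(f) = (m + 1) · |Kset m k|`** (count the pairs (class, empty block) by the empty block). -/
theorem sum_zf_Kset (m k : ℕ) : ∑ f ∈ Kset (m + 1) k, zf f = (m + 1) * (Kset m k).card := by
  simp_rw [zf_eq_card, Finset.card_filter]
  rw [Finset.sum_comm]
  simp_rw [← Finset.card_filter, card_filter_empty_at]
  rw [Finset.sum_const, Finset.card_univ, Fintype.card_fin, smul_eq_mul]

/-! ## §4. THE OVERLAP IDENTITY for the blocks of the `n`-fold surface box -/

/-- **THE BLOCKS OF THE `n`-FOLD SURFACE BOX OVERLAP BY EXACTLY `n · [t^k](1 + 4t + t²)^{n−1}`**: for every field, `n ≥ 2`, `k` and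
`a, c ≠ 0`, `Σ_{q ≤ 2n} rank(q-block of θ ↦ θ ∧ F_n ∣ ⋀^k) = [t^k](1+4t+t²)ⁿ + n·[t^k](1+4t+t²)^{n−1}` (= total rank + one term
`[t^k]P_2^{n−1}` per empty factor: the source `1` of an empty factor is ONE vector `a E_X + c E_Y` with components in two blocks —
th-6's coincidence; the surface-power analogue of the two-factor identity `Σ_q rank_q = rank + 2r_k(n)` of
`WedgeBoxPerQOverlap.sum_finrank_range_blockProj_eq`). -/
theorem sum_finrank_range_blockProj_wedge_surfaceBox {m : ℕ} (hm : 1 ≤ m) {a c : K} (ha : a ≠ 0) (hc : c ≠ 0) (k : ℕ) :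
    ∑ q ∈ Finset.range (2 * (m + 1) + 1),
        finrank K (LinearMap.range (blockProj K (m + 1) q ∘ₗ wedge K (Fin (4 * (m + 1))) k (surfaceBox K (n := m + 1) a c))) =
      (surfPoly ^ (m + 1)).coeff k + (m + 1) * (surfPoly ^ m).coeff k := by
  simp_rw [finrank_range_blockProj_wedge_surfaceBox_eq_card K ha hc]
  rw [sum_card_Fset, sum_zf_Kset, card_Kset (by omega), card_Kset hm]

/-- in terms of the total rank: `Σ_{q ≤ 2n} rank_q = rank(θ ↦ θ ∧ F_n ∣ ⋀^k) + n · rank(θ ↦ θ ∧ F_{n−1} ∣ ⋀^k)`. -/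
theorem sum_finrank_range_blockProj_eq_add {m : ℕ} (hm : 1 ≤ m) {a c : K} (ha : a ≠ 0) (hc : c ≠ 0) (k : ℕ) :
    ∑ q ∈ Finset.range (2 * (m + 1) + 1),
        finrank K (LinearMap.range (blockProj K (m + 1) q ∘ₗ wedge K (Fin (4 * (m + 1))) k (surfaceBox K (n := m + 1) a c))) =
      finrank K (LinearMap.range (wedge K (Fin (4 * (m + 1))) k (surfaceBox K (n := m + 1) a c))) +
        (m + 1) * finrank K (LinearMap.range (wedge K (Fin (4 * m)) k (surfaceBox K (n := m) a c))) := by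
  rw [sum_finrank_range_blockProj_wedge_surfaceBox K hm ha hc, finrank_range_surfaceBox K (by omega) ha hc,
    finrank_range_surfaceBox K hm ha hc]

/-- the instance of record (`FormulaNSurfacePowerPerQ.spCount_sum_three_two`: block sum `105`, total rank `51` at `n = 3`, `k = 2`):
`105 = 51 + 3·18` (`18 = [t²](1+4t+t²)²`, the two-factor rank); and `n = 4`: `304 = 100 + 4·51`. -/
theorem overlap_instances {a c : K} (ha : a ≠ 0) (hc : c ≠ 0) :
    ∑ q ∈ Finset.range 7,
        finrank K (LinearMap.range (blockProj K 3 q ∘ₗ wedge K (Fin (4 * 3)) 2 (surfaceBox K (n := 3) a c))) = 51 + 3 * 18 ∧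
    ∑ q ∈ Finset.range 9,
        finrank K (LinearMap.range (blockProj K 4 q ∘ₗ wedge K (Fin (4 * 4)) 2 (surfaceBox K (n := 4) a c))) = 100 + 4 * 51 := by
  refine ⟨?_, ?_⟩
  · rw [show Finset.range 7 = Finset.range (2 * (2 + 1) + 1) from rfl,
      sum_finrank_range_blockProj_wedge_surfaceBox K (m := 2) (by omega) ha hc, (coeff_surfPoly_pow (2 + 1)).2.2.1,
      (coeff_surfPoly_pow 2).2.2.1]
    decide
  · rw [show Finset.range 9 = Finset.range (2 * (3 + 1) + 1) from rfl,
      sum_finrank_range_blockProj_wedge_surfaceBox K (m := 3) (by omega) ha hc, (coeff_surfPoly_pow (3 + 1)).2.2.1,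
      (coeff_surfPoly_pow 3).2.2.1]
    decide


/-! ## §5. th-7 §G's `η`-WEIGHTS: the weight blocks of the surface box are the `q`-blocks, `w = 2n − k − 2q` -/

variable (n) in
/-- th-7 PART B §G's `η`-weight of a target monomial (quoted convention, as in `WedgeBoxPerQOverlap.kweight`: `+1` per `X`-letter,
`−1` per `Y`-letter): `w(T) = #(T ∩ XX) − #(T ∖ XX)`. -/
def kweight (T : Finset (Fin (4 * n))) : ℤ := ((T ∩ XX n).card : ℤ) - ((T \ XX n).card : ℤ)

/-- the `X`-generators number `2n`. -/
lemma card_XX : (XX n).card = 2 * n := by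
  rw [XX, Finset.card_biUnion]
  · simp_rw [card_lift]
    rw [show X4.card = 2 by decide, Finset.sum_const, Finset.card_univ, Fintype.card_fin, smul_eq_mul, mul_comm]
  · intro i _ i' _ h
    exact disjoint_of_subsets (disjoint_D h) (lift_subset_D i _) (lift_subset_D i' _)

/-- **`η`-weight and Dolbeault index are affinely related on the degree-`(k + 2n)` monomials: `w = 2n − k − 2q`** — so th-7 §G's
weight blocks of `θ ↦ θ ∧ F_n ∣ ⋀^k` ARE the `q`-blocks (same statement as the two-factor `WedgeBoxPerQOverlap.kweight_eq`), and
every rank statement of file 3/3 reads verbatim for the weight-`w` block with `q = (2n − k − w)/2`. -/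
theorem kweight_eq {k : ℕ} {T : Finset (Fin (4 * n))} (hT : T.card = k + 2 * n) :
    kweight n T = (2 * n : ℤ) - k - 2 * (qdeg n T : ℤ) := by
  have h1 : (T ∩ XX n).card + (XX n \ T).card = 2 * n := by
    rw [← card_XX (n := n), ← Finset.card_sdiff_add_card_inter (XX n) T, Finset.inter_comm, add_comm]
  have h2 : (T ∩ XX n).card + (T \ XX n).card = k + 2 * n := by
    rw [← hT, ← Finset.card_inter_add_card_sdiff T (XX n)]
  unfold kweight qdeg
  omega


/-! ## §5b. The per-`q` RANK rows in degrees 1, 2, 3 in closed form, every `n` (`FormulaNSurfacePowerPerQClosed.lean` + the rank theorem) -/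

/-- **degree 1, every `n ≥ 1`: the `q`-block of `θ ↦ θ ∧ F_n` on `⋀¹ K^{4n}` has rank `2n` for `q ≤ 2n − 1`, `0` beyond.** -/
theorem finrank_range_blockProj_wedge_surfaceBox_one_closed (hn : 1 ≤ n) {a c : K} (ha : a ≠ 0) (hc : c ≠ 0) (q : ℕ) :
    finrank K (LinearMap.range (blockProj K n q ∘ₗ wedge K (Fin (4 * n)) 1 (surfaceBox K (n := n) a c))) =
      if q < 2 * n then 2 * n else 0 := by
  rw [finrank_range_blockProj_wedge_surfaceBox K ha hc, FormulaN.Uniform.spCount_one_closed hn]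

/-- **degree 2, every `n ≥ 2` (C10's per-q refinement in closed form): `2n² − n` at `q ∈ {0, 2n−2}`, `4n² − 4n` at odd `q ≤ 2n−3`,
`4n² − 3n` at the inner even `q`, `0` beyond `2n − 2`.** -/
theorem finrank_range_blockProj_wedge_surfaceBox_two_closed (hn : 2 ≤ n) {a c : K} (ha : a ≠ 0) (hc : c ≠ 0) (q : ℕ) :
    finrank K (LinearMap.range (blockProj K n q ∘ₗ wedge K (Fin (4 * n)) 2 (surfaceBox K (n := n) a c))) =
      if 2 * n - 2 < q then 0
      else if q = 0 ∨ q = 2 * n - 2 then 2 * n ^ 2 - n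
      else if q % 2 = 1 then 4 * n ^ 2 - 4 * n else 4 * n ^ 2 - 3 * n := by
  rw [finrank_range_blockProj_wedge_surfaceBox K ha hc, FormulaN.Uniform.spCount_two_closed hn]

/-- **degree 3, every `n ≥ 3`: `4C(n,2) + 8C(n,3)` at `q ∈ {0, 2n−3}`, `4C(n,2) + 24C(n,3)` at `q ∈ {1, 2n−4}`, the constant
`4C(n,2) + 32C(n,3)` for `2 ≤ q ≤ 2n−5`, `0` beyond.** -/
theorem finrank_range_blockProj_wedge_surfaceBox_three_closed (hn : 3 ≤ n) {a c : K} (ha : a ≠ 0) (hc : c ≠ 0) (q : ℕ) :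
    finrank K (LinearMap.range (blockProj K n q ∘ₗ wedge K (Fin (4 * n)) 3 (surfaceBox K (n := n) a c))) =
      if 2 * n - 3 < q then 0
      else if q = 0 ∨ q = 2 * n - 3 then 4 * n.choose 2 + 8 * n.choose 3
      else if q = 1 ∨ q = 2 * n - 4 then 4 * n.choose 2 + 24 * n.choose 3
      else 4 * n.choose 2 + 32 * n.choose 3 := by
  rw [finrank_range_blockProj_wedge_surfaceBox K ha hc, FormulaN.Uniform.spCount_three_closed hn]

/-! ## §6. Under saturation the block ranks OF `σ` are these numbers ((S2) ⇒ per-q for surface powers, inputs by value) -/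

section Saturation

variable {Ext2 : Type*} [AddCommGroup Ext2] [Module K Ext2] [FiniteDimensional K Ext2]

/-- **(S2) ⇒ PER-q FOR THE `n`-FOLD SURFACE BOX** (STRUCTURE (S2) «δ_E = 0 ⇒ σ_E injective in EVERY degree (saturation: ev onto)»
combined with the per-q rank theorem; the bridge `σ ∘ ev = (θ ↦ θ ∧ F_n)` ([BF08] 6.4.2, on paper) and the EXTREMAL count
`dim Ext^k(F_n, F_n) = [t^k](1 + 4t + t²)ⁿ` (C10: `8n² − 7n` in degree 2) are HYPOTHESES BY VALUE, as in `FormulaN.Uniform.model_saturation`):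
for ANY finite-dimensional `Ext2`, `ev : ⋀^k K^{4n} → Ext2`, `σ : Ext2 → ⋀ K^{4n}` with `σ ∘ ev = (θ ↦ θ ∧ F_n)` and
`dim Ext2 = [t^k](1+4t+t²)ⁿ` (`n ≥ 1`), `ev` is onto, `σ` is injective, and **the `q`-block of `σ` ITSELF has rank `spCount n k q`**
for every `q` — the form in which th-6 §4.1 prints the measured rows («F₃ Ext² per-q (15,24,27,24,15)»).  Nothing here identifies
`Ext2` with an Ext group of a sheaf. -/
theorem finrank_range_blockProj_sigma_of_saturation (hn : 1 ≤ n) {a c : K} (ha : a ≠ 0) (hc : c ≠ 0) (k : ℕ)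
    (ev : (⋀[K]^k (Fin (4 * n) → K)) →ₗ[K] Ext2) (σ : Ext2 →ₗ[K] HT K (Fin (4 * n)))
    (bridge : σ ∘ₗ ev = wedge K (Fin (4 * n)) k (surfaceBox K (n := n) a c))
    (hExt : finrank K Ext2 = (surfPoly ^ n).coeff k) (q : ℕ) :
    Function.Surjective ev ∧ Function.Injective σ ∧
      finrank K (LinearMap.range (blockProj K n q ∘ₗ σ)) = FormulaN.Uniform.spCount n k q := by
  obtain ⟨hsurj, hinj, -, -, -⟩ :=
    FormulaN.Squeeze.theoremS ev σ _ bridge _ (finrank_range_surfaceBox K hn ha hc k) hExt.le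
  refine ⟨hsurj, hinj, ?_⟩
  rw [WedgeBox.range_comp_eq_of_bridge_of_surjective K ev σ _ bridge hsurj, finrank_range_blockProj_wedge_surfaceBox K ha hc]

end Saturation

end Summit.Ventures.HSemireg.Wedge.SurfacePowers
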